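import Literature.AlgebraicGeometry.Motives.BaseChangePointsProofs
import Literature.NumberTheory.Transcendental.Analytification
import Mathlib.FieldTheory.Minpoly.Field
import HarnessLib

/-!
# `L`-points of a restriction of scalars: the decomposition along the embeddings `K → L`

Layer `Literature/AlgebraicGeometry/Motives`, companion to `AlgPoints` (the `L`-valued points
`X(L)` of a `k`-scheme with their strong topology), `BaseChange` / `BaseChangePointsProofs`
(`X(L) ≃ₜ X_σ(L)` for a base change along `σ : k → L`). Written for the provefact seat of
`Literature.NumberTheory.EllipticCurves.ModularForms.nonempty_schollBettiRealisation` (Scholl's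
motive of a newform): there the Kuga–Sato variety `W` is constructed over a number field
`K = ℚ(ζ_n)` (`Literature.NumberTheory.EllipticCurves.KugaSatoVariety`) and Scholl's `ℚ`-scheme
`X̄̄_nʷ` is `W` regarded over `ℚ`; its complex points, on which the Betti realisation
`H^{k-1}(W|_ℚ(ℂ); ℚ)` and the infinite Frobenius `F_∞` live, are the disjoint union of the
conjugate complex manifolds `W_σ(ℂ)`, `σ : K → ℂ` (Deninger–Scholl 1991, §4.1: `M_n ⊗ ℂ` is
"the disjoint union of `φ(n)` copies of `Γ(n)∖ℍ`"), permuted by complex conjugation through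
`σ ↦ σ̄`. This file proves that decomposition for the `L`-points of an arbitrary `K`-scheme
`Z` regarded over a subfield `k ⊆ K` with `[K : k] < ∞`, for any field `L ⊇ k`:

* `SchemeOver.restrictScalars k Z` — restriction of scalars `Z ↦ (Z → Spec K → Spec k)`, an
  `abbrev` for Mathlib's `Over.map (Spec K → Spec k)` (EGA I, 2.5.1; Hartshorne II.2–3).
* `AlgPoints.embOfPoint Z P : K →ₐ[k] L` — the embedding `σ_P` attached to `P ∈ Z|_k(L)` (the
  ring map of `Spec L ⟶ Z ⟶ Spec K`); `embOfPoint_apply`: **`σ_P(a) = a(P)`**, the value at `P` of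
  the global regular function `a ∈ K` (`AlgPoints.scalarFn`), whence `σ_P(a)` is continuous in
  `P` (`continuous_embOfPoint_apply`).
* `isClopen_setOf_embOfPoint_eq` — for `L` a `T₁` topological field the pieces
  `{P | σ_P = σ}` are **clopen** (closed: `σ_P` is determined by continuous values; open: on a
  `k`-basis `bᵢ` of `K` the value `σ_P(bᵢ)` avoids the finite set `{τ(bᵢ) ≠ σ(bᵢ)}`, `τ` ranging
  over the finitely many `k`-embeddings, Mathlib `AlgHom.fintype`); they cover and are pairwise
  disjoint (`iUnion_setOf_embOfPoint_eq`, `disjoint_setOf_embOfPoint_eq`).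
* `AlgPoints.pieceHomeomorph Z σ : Z(L)_σ ≃ₜ {P | σ_P = σ}` — **each piece is `Z(L)` with `L` a
  `K`-algebra through `σ`** (same underlying morphisms `Spec L ⟶ Z`; both strong topologies are
  generated by the values of the same regular functions on the same opens), so that with
  `AlgPoints.isHomeomorph_baseChangeEquiv_holds` each piece is `(Z ⊗_{K,σ} L)(L)`.
* `embOfPoint_smul` — **`Aut(L/k)` permutes the pieces**: `σ_{τ • P} = τ ∘ σ_P` for the tree's
  left action `τ • P = Spec τ ≫ P`; in particular complex conjugation of `Z|_ℚ(ℂ)` carries the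
  piece of `σ` onto the piece of `σ̄` (`smul_mem_setOf_embOfPoint_eq_iff`).

On points (as opposed to schemes: `Spec (K ⊗_k L) = ∐_σ Spec L` needs `L` to split `K/k`) no
separability or splitting hypothesis is needed: `Hom_k(Spec L, Spec K) = Hom_k(K, L)` for any
field `L`. Everything is proved; no named facts (D-0014). Mathlib searched (pin): `Over.map`,
`Spec.preimage`, `Spec.map_injective`, `AlgHom.fintype`, `Module.finBasis` (used); there is no
restriction-of-scalars functor for schemes under a dedicated name and no notion of `L`-points
with topology (the tree's `Motives/AlgPoints`).

## References

* A. Grothendieck, J. Dieudonné, *Éléments de géométrie algébrique I* (Springer 1971), 2.5.1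
  (`S`-préschéma "considéré comme" `S'`-préschéma), 3.4 (points with values in a field).
  [GrothendieckDieudonne1971]
* R. Hartshorne, *Algebraic Geometry* (1977), II.2, II Ex. 2.7 (`K`-valued points), II.3.
  [Hartshorne1977]
* C. Deninger, A. J. Scholl, *The Beilinson conjectures*, in *L-functions and Arithmetic*
  (Durham 1989), LMS LNS 153, CUP 1991, §4.1 and 5.1 (the application). [DeningerScholl1991]
* B. Conrad, *Weil and Grothendieck approaches to adelic points*, Enseign. Math. 58 (2012),
  Prop. 2.1 (functoriality of the topology on points). [ConradAdelicPoints2012]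
-/

universe u

open CategoryTheory AlgebraicGeometry Limits Topology

noncomputable section

namespace Literature.AlgebraicGeometry.Motives

section RestrictScalarsDef

variable (k : Type u) {K : Type u} [CommRing k] [CommRing K] [Algebra k K]

/-- **Restriction of scalars** of a `K`-scheme to a `k`-scheme along `k → K`: `Z ↦ (Z → Spec K →
Spec k)`, i.e. Mathlib's `Over.map (Spec K → Spec k)` (Hartshorne II.2–II.3: a scheme over `K`
"regarded as a scheme over `k`"; EGA I 2.5). An `abbrev`, so that all `Over.map` lemmas apply.
[folklore] -/
abbrev SchemeOver.restrictScalars (Z : SchemeOver K) : SchemeOver k :=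
  (Over.map (Spec.map (CommRingCat.ofHom (algebraMap k K)))).obj Z

/-- The underlying scheme is unchanged. [folklore] -/
theorem SchemeOver.restrictScalars_left (Z : SchemeOver K) : (Z.restrictScalars k).left = Z.left :=
  rfl

/-- The structure morphism of the restriction of scalars is `Z → Spec K → Spec k`. [folklore] -/
theorem SchemeOver.restrictScalars_hom (Z : SchemeOver K) :
    (Z.restrictScalars k).hom = Z.hom ≫ Spec.map (CommRingCat.ofHom (algebraMap k K)) :=
  rfl

end RestrictScalarsDef

namespace AlgPoints

section RestrictScalars

variable {k K : Type u} [Field k] [Field K] [Algebra k K] (Z : SchemeOver K)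
  {L : Type u} [Field L] [Algebra k L]

/-- The `k`-embedding `σ_P : K → L` attached to an `L`-point `P` of the `K`-scheme `Z` regarded
over `k`: the ring map of `Spec L ⟶ Z ⟶ Spec K` (it is over `k` because `P` is). [folklore] -/
def embOfPoint (P : AlgPoints (Z.restrictScalars k) L) : K →ₐ[k] L where
  toRingHom := (Spec.preimage (P.left ≫ Z.hom)).hom
  commutes' c := by
    have hw := Over.w P
    rw [Over.map_obj_hom] at hw
    -- `hw : P.left ≫ Z.hom ≫ Spec (k → K) = Spec (k → L)`
    have h1 : Spec.map (CommRingCat.ofHom (algebraMap k K) ≫ Spec.preimage (P.left ≫ Z.hom)) =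
        Spec.map (CommRingCat.ofHom (algebraMap k L)) := by
      rw [Spec.map_comp, Spec.map_preimage, Category.assoc]
      exact hw
    have h2 := congrArg (fun f : CommRingCat.of k ⟶ CommRingCat.of L ↦ f.hom c)
      (Spec.map_injective h1)
    simpa using h2

/-- The ring map underlying `σ_P` is the preimage under `Spec` of `Spec L ⟶ Z ⟶ Spec K`. [folklore] -/
theorem embOfPoint_toRingHom (P : AlgPoints (Z.restrictScalars k) L) :
    (embOfPoint Z P).toRingHom = (Spec.preimage (P.left ≫ Z.hom)).hom :=
  rfl

/-- `Spec σ_P = (Spec L ⟶ Z ⟶ Spec K)`. [folklore] -/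
theorem specMap_ofHom_embOfPoint (P : AlgPoints (Z.restrictScalars k) L) :
    Spec.map (CommRingCat.ofHom (embOfPoint Z P).toRingHom) = P.left ≫ Z.hom := by
  rw [embOfPoint_toRingHom, CommRingCat.ofHom_hom, Spec.map_preimage]
  rfl

/-- The global regular function on `Z` given by a scalar `a ∈ K` (pull-back of `a ∈ Γ(Spec K, 𝒪)`
along the structure morphism). [folklore] -/
def scalarFn (a : K) : Γ(Z.left, ⊤) :=
  Z.hom.appTop ((Scheme.ΓSpecIso (.of K)).inv a)

/-- Evaluation on `⊤` and on `(Z → Spec K)⁻¹ ⊤` agree (definitionally). [folklore] -/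
theorem eval_top_eq_eval_preimage_top (P : AlgPoints (Z.restrictScalars k) L)
    (f : Γ(Z.left, ⊤)) :
    P.eval ⊤ trivial f = P.eval (Z.hom ⁻¹ᵁ ⊤) trivial f :=
  rfl

/-- **`σ_P(a) = a(P)`**: the embedding attached to `P` sends `a ∈ K` to the value at `P` of the
global regular function `a` on `Z` (both are the pull-back of `a` to `Γ(Spec L, 𝒪) = L`).
[folklore] -/
theorem embOfPoint_apply (P : AlgPoints (Z.restrictScalars k) L) (a : K) :
    embOfPoint Z P a = P.eval ⊤ trivial (scalarFn Z a) := by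
  rw [eval_top_eq_eval_preimage_top, eval_eq_appLE]
  have key : ∀ (p : Spec (.of L) ⟶ Z.left) (e : (⊤ : (Spec (.of L)).Opens) ≤ p ⁻¹ᵁ (Z.hom ⁻¹ᵁ ⊤))
      (φ : CommRingCat.of K ⟶ CommRingCat.of L), p ≫ Z.hom = Spec.map φ →
        (Scheme.ΓSpecIso (.of L)).hom (p.appLE (Z.hom ⁻¹ᵁ ⊤) ⊤ e (scalarFn Z a)) = φ.hom a := by
    intro p e φ hp
    have h1 : scalarFn Z a =
        Z.hom.appLE ⊤ (Z.hom ⁻¹ᵁ ⊤) le_rfl ((Scheme.ΓSpecIso (.of K)).inv a) := by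
      rw [scalarFn, Scheme.Hom.appTop, Scheme.Hom.app_eq_appLE Z.hom]
      rfl
    have h2 : p.appLE (Z.hom ⁻¹ᵁ ⊤) ⊤ e
          (Z.hom.appLE ⊤ (Z.hom ⁻¹ᵁ ⊤) le_rfl ((Scheme.ΓSpecIso (.of K)).inv a)) =
        (p ≫ Z.hom).appLE ⊤ ⊤ le_top ((Scheme.ΓSpecIso (.of K)).inv a) :=
      CategoryTheory.congr_fun
        (Scheme.Hom.appLE_comp_appLE p Z.hom ⊤ (Z.hom ⁻¹ᵁ ⊤) ⊤ le_rfl e) _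
    rw [h1, h2]
    have h3 : ∀ (q : Spec (.of L) ⟶ Spec (.of K)) (e' : (⊤ : (Spec (.of L)).Opens) ≤ q ⁻¹ᵁ ⊤),
        q = Spec.map φ →
          (Scheme.ΓSpecIso (.of L)).hom (q.appLE ⊤ ⊤ e' ((Scheme.ΓSpecIso (.of K)).inv a)) =
            φ.hom a := by
      rintro q e' rfl
      rw [ΓSpecIso_hom_SpecMap_appLE_top]
      simp
    exact h3 (p ≫ Z.hom) le_top hp
  refine ((key P.left _ (CommRingCat.ofHom (embOfPoint Z P).toRingHom)
    (specMap_ofHom_embOfPoint Z P).symm).trans ?_).symm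
  rfl

/-! #### Continuity and the clopen partition by embeddings -/

/-- The value `σ_P(a)` of the embedding attached to `P` is a continuous function of `P` for the
strong topology (it is the value at `P` of the global regular function `a`). [folklore] -/
theorem continuous_embOfPoint_apply [TopologicalSpace L] (a : K) :
    Continuous fun P : AlgPoints (Z.restrictScalars k) L ↦ embOfPoint Z P a := by
  have h : (fun P : AlgPoints (Z.restrictScalars k) L ↦ embOfPoint Z P a) =
      evalOrZero (X := Z.restrictScalars k) ⊤ (scalarFn Z a) := by
    funext P
    rw [embOfPoint_apply,
      evalOrZero_of_mem (X := Z.restrictScalars k) _ (TopologicalSpace.Opens.mem_top P.pt)]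
  rw [h]
  exact continuous_evalOrZero_top (X := Z.restrictScalars k) _

/-- The locus of `L`-points of `Z|_k` inducing a given embedding `σ : K → L` is closed (for `L`
a `T₁` topological field). [folklore] -/
theorem isClosed_setOf_embOfPoint_eq [TopologicalSpace L] [T1Space L] (σ : K →ₐ[k] L) :
    IsClosed {P : AlgPoints (Z.restrictScalars k) L | embOfPoint Z P = σ} := by
  have h : {P : AlgPoints (Z.restrictScalars k) L | embOfPoint Z P = σ} =
      ⋂ a : K, (fun P ↦ embOfPoint Z P a) ⁻¹' {σ a} := by
    ext P
    simp only [Set.mem_setOf_eq, Set.mem_iInter, Set.mem_preimage, Set.mem_singleton_iff,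
      AlgHom.ext_iff]
  rw [h]
  exact isClosed_iInter fun a ↦ isClosed_singleton.preimage (continuous_embOfPoint_apply Z a)

/-- The locus of `L`-points of `Z|_k` inducing a given embedding `σ : K → L` is open when `K/k`
is finite: `σ_P` is determined by finitely many values `σ_P(bᵢ)` on a basis, each of which ranges
over the finite set `{τ(bᵢ)}`, `τ` running through the finitely many `k`-embeddings `K → L`.
[folklore] -/
theorem isOpen_setOf_embOfPoint_eq [TopologicalSpace L] [T1Space L] [FiniteDimensional k K]
    (σ : K →ₐ[k] L) :
    IsOpen {P : AlgPoints (Z.restrictScalars k) L | embOfPoint Z P = σ} := by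
  classical
  let b := Module.finBasis k K
  have h : {P : AlgPoints (Z.restrictScalars k) L | embOfPoint Z P = σ} =
      ⋂ i, {P | embOfPoint Z P (b i) = σ (b i)} := by
    ext P
    simp only [Set.mem_setOf_eq, Set.mem_iInter]
    constructor
    · intro hP i
      rw [hP]
    · intro hP
      apply AlgHom.toLinearMap_injective
      exact b.ext fun i ↦ hP i
  rw [h]
  refine isOpen_iInter_of_finite fun i ↦ ?_
  -- the finitely many "wrong" values `τ(bᵢ) ≠ σ(bᵢ)`
  let S : Set L := (Set.range fun τ : K →ₐ[k] L ↦ τ (b i)) \ {σ (b i)}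
  have hS : S.Finite := (Set.finite_range _).subset Set.sdiff_subset
  have h2 : {P : AlgPoints (Z.restrictScalars k) L | embOfPoint Z P (b i) = σ (b i)} =
      (fun P ↦ embOfPoint Z P (b i)) ⁻¹' Sᶜ := by
    ext P
    simp only [Set.mem_setOf_eq, Set.mem_preimage, Set.mem_compl_iff, S, Set.mem_sdiff,
      Set.mem_range, Set.mem_singleton_iff, not_and, not_not]
    constructor
    · intro hP _
      exact hP
    · intro hP
      exact hP ⟨embOfPoint Z P, rfl⟩
  rw [h2]
  exact hS.isClosed.isOpen_compl.preimage (continuous_embOfPoint_apply Z (b i))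

/-- For `K/k` finite and `L` a `T₁` topological field, the loci `{P | σ_P = σ}` are clopen in
`Z|_k(L)`; they partition it according to the `k`-embeddings `σ : K → L`. [folklore] -/
theorem isClopen_setOf_embOfPoint_eq [TopologicalSpace L] [T1Space L] [FiniteDimensional k K]
    (σ : K →ₐ[k] L) :
    IsClopen {P : AlgPoints (Z.restrictScalars k) L | embOfPoint Z P = σ} :=
  ⟨isClosed_setOf_embOfPoint_eq Z σ, isOpen_setOf_embOfPoint_eq Z σ⟩

/-! #### The pieces are the `L`-points of `Z` over `K` along `σ` -/

/-- An `L`-point of `Z` over `K`, `L` being a `K`-algebra through `σ`, regarded as an `L`-point of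
`Z|_k` (same underlying morphism `Spec L ⟶ Z`). [folklore] -/
def ofAlong (σ : K →ₐ[k] L) (Q : letI := σ.toRingHom.toAlgebra; AlgPoints Z L) :
    AlgPoints (Z.restrictScalars k) L :=
  letI := σ.toRingHom.toAlgebra
  Over.homMk Q.left (by
    have hw : Q.left ≫ Z.hom = Spec.map (CommRingCat.ofHom (σ : K →+* L)) := Over.w Q
    have h2 : Spec.map (CommRingCat.ofHom (σ : K →+* L)) ≫
          Spec.map (CommRingCat.ofHom (algebraMap k K)) =
        Spec.map (CommRingCat.ofHom (algebraMap k L)) := by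
      rw [← Spec.map_comp, ← CommRingCat.ofHom_comp, AlgHom.comp_algebraMap]
    exact (Category.assoc _ _ _).symm.trans
      ((congrArg (· ≫ Spec.map (CommRingCat.ofHom (algebraMap k K))) hw).trans h2))

/-- `ofAlong` does not change the underlying morphism. [folklore] -/
@[simp]
theorem ofAlong_left (σ : K →ₐ[k] L) (Q : letI := σ.toRingHom.toAlgebra; AlgPoints Z L) :
    (ofAlong Z σ Q).left = (letI := σ.toRingHom.toAlgebra; Q.left) :=
  rfl

/-- The embedding attached to `ofAlong σ Q` is `σ`. [folklore] -/
theorem embOfPoint_ofAlong (σ : K →ₐ[k] L) (Q : letI := σ.toRingHom.toAlgebra; AlgPoints Z L) :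
    embOfPoint Z (ofAlong Z σ Q) = σ := by
  letI := σ.toRingHom.toAlgebra
  ext a
  have hw : (ofAlong Z σ Q).left ≫ Z.hom = Spec.map (CommRingCat.ofHom (σ : K →+* L)) := Over.w Q
  have h2 : Spec.preimage ((ofAlong Z σ Q).left ≫ Z.hom) = CommRingCat.ofHom (σ : K →+* L) := by
    apply Spec.map_injective
    rw [Spec.map_preimage]
    exact hw
  change (Spec.preimage ((ofAlong Z σ Q).left ≫ Z.hom)).hom a = σ a
  rw [h2]
  rfl

/-- Conversely, an `L`-point `P` of `Z|_k` is an `L`-point of `Z` over `K` along `σ_P` (same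
underlying morphism). [folklore] -/
def toAlong (P : AlgPoints (Z.restrictScalars k) L) :
    letI := (embOfPoint Z P).toRingHom.toAlgebra; AlgPoints Z L :=
  letI := (embOfPoint Z P).toRingHom.toAlgebra
  Over.homMk P.left (by
    change P.left ≫ Z.hom = Spec.map (CommRingCat.ofHom (embOfPoint Z P).toRingHom)
    rw [specMap_ofHom_embOfPoint])

/-- `toAlong` does not change the underlying morphism. [folklore] -/
@[simp]
theorem toAlong_left (P : AlgPoints (Z.restrictScalars k) L) :
    (letI := (embOfPoint Z P).toRingHom.toAlgebra; (toAlong Z P).left) = P.left :=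
  rfl

/-- `ofAlong ∘ toAlong = id`. [folklore] -/
theorem ofAlong_toAlong (P : AlgPoints (Z.restrictScalars k) L) :
    ofAlong Z (embOfPoint Z P) (toAlong Z P) = P := by
  ext : 1
  rfl

/-! #### The homeomorphism of a piece with `Z(L)` along `σ` -/

/-- `ofAlong σ` pulls sub-basic open sets back to the same sub-basic open sets (points and values
of regular functions only depend on the underlying morphism `Spec L ⟶ Z`). [folklore] -/
theorem preimage_ofAlong_basicSet [TopologicalSpace L] (σ : K →ₐ[k] L) (U : Z.left.Opens)
    (f : Γ(Z.left, U)) (V : Set L) :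
    (ofAlong Z σ) ⁻¹' (basicSet (X := Z.restrictScalars k) U f V) =
      (letI := σ.toRingHom.toAlgebra; (basicSet U f V : Set (AlgPoints Z L))) :=
  rfl

/-- `ofAlong σ : Z(L)_σ → Z|_k(L)` is continuous for the strong topologies. [folklore] -/
theorem continuous_ofAlong [TopologicalSpace L] (σ : K →ₐ[k] L) :
    Continuous (ofAlong Z σ : (letI := σ.toRingHom.toAlgebra; AlgPoints Z L) →
      AlgPoints (Z.restrictScalars k) L) := by
  letI := σ.toRingHom.toAlgebra
  refine continuous_generateFrom_iff.mpr ?_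
  rintro _ ⟨U, f, V, hV, rfl⟩
  rw [preimage_ofAlong_basicSet]
  exact isOpen_basicSet _ _ hV

/-- The inverse map on the piece `{P | σ_P = σ}`: an `L`-point of `Z|_k` with `σ_P = σ` as an
`L`-point of `Z` over `K` along `σ`. [folklore] -/
def ofPiece (σ : K →ₐ[k] L) (P : {P : AlgPoints (Z.restrictScalars k) L // embOfPoint Z P = σ}) :
    letI := σ.toRingHom.toAlgebra; AlgPoints Z L :=
  letI := σ.toRingHom.toAlgebra
  Over.homMk P.1.left (by
    have h := specMap_ofHom_embOfPoint Z P.1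
    rw [P.2] at h
    exact h.symm)

/-- `ofPiece` does not change the underlying morphism. [folklore] -/
@[simp]
theorem ofPiece_left (σ : K →ₐ[k] L)
    (P : {P : AlgPoints (Z.restrictScalars k) L // embOfPoint Z P = σ}) :
    (letI := σ.toRingHom.toAlgebra; (ofPiece Z σ P).left) = P.1.left :=
  rfl

/-- `ofPiece σ` pulls sub-basic open sets back to traces of sub-basic open sets. [folklore] -/
theorem preimage_ofPiece_basicSet [TopologicalSpace L] (σ : K →ₐ[k] L) (U : Z.left.Opens)
    (f : Γ(Z.left, U)) (V : Set L) :
    (ofPiece Z σ) ⁻¹' (letI := σ.toRingHom.toAlgebra; (basicSet U f V : Set (AlgPoints Z L))) =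
      Subtype.val ⁻¹' (basicSet (X := Z.restrictScalars k) U f V) :=
  rfl

/-- `ofPiece σ` is continuous. [folklore] -/
theorem continuous_ofPiece [TopologicalSpace L] (σ : K →ₐ[k] L) :
    Continuous (ofPiece Z σ : _ → (letI := σ.toRingHom.toAlgebra; AlgPoints Z L)) := by
  letI := σ.toRingHom.toAlgebra
  refine continuous_generateFrom_iff.mpr ?_
  rintro _ ⟨U, f, V, hV, rfl⟩
  rw [preimage_ofPiece_basicSet]
  exact (isOpen_basicSet _ _ hV).preimage continuous_subtype_val

/-- **The piece `{P ∈ Z|_k(L) | σ_P = σ}` is homeomorphic to `Z(L)`, `L` a `K`-algebra through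
`σ`** (same underlying morphisms `Spec L ⟶ Z`; the strong topologies on both sides are generated
by the values of the same regular functions on the same opens of `Z`). Together with
`isClopen_setOf_embOfPoint_eq` this is the decomposition
`Z|_k(L) = ∐_{σ : K → L} Z ⊗_{K,σ} L (L)` — e.g. for a smooth projective `W` over a number field
`K`, `W|_ℚ(ℂ)` is the disjoint union of the `[K : ℚ]` conjugate complex manifolds `W_σ(ℂ)`
(Deninger–Scholl 1991, §4.1: `M_n ⊗ ℂ` is "the disjoint union of `φ(n)` copies of `Γ(n)∖ℍ`";
Serre 1964). [folklore] -/
def pieceHomeomorph [TopologicalSpace L] (σ : K →ₐ[k] L) :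
    (letI := σ.toRingHom.toAlgebra; AlgPoints Z L) ≃ₜ
      {P : AlgPoints (Z.restrictScalars k) L // embOfPoint Z P = σ} where
  toFun Q := ⟨ofAlong Z σ Q, embOfPoint_ofAlong Z σ Q⟩
  invFun := ofPiece Z σ
  left_inv Q := by
    letI := σ.toRingHom.toAlgebra
    ext : 1
    rfl
  right_inv P := by
    apply Subtype.ext
    ext : 1
    rfl
  continuous_toFun := (continuous_ofAlong Z σ).subtype_mk _
  continuous_invFun := continuous_ofPiece Z σ

/-- `pieceHomeomorph σ Q` has underlying point `ofAlong σ Q`. [folklore] -/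
@[simp]
theorem pieceHomeomorph_apply_coe [TopologicalSpace L] (σ : K →ₐ[k] L)
    (Q : letI := σ.toRingHom.toAlgebra; AlgPoints Z L) :
    ((pieceHomeomorph Z σ Q : {P : AlgPoints (Z.restrictScalars k) L // embOfPoint Z P = σ}) :
      AlgPoints (Z.restrictScalars k) L) = ofAlong Z σ Q :=
  rfl

/-- Every `L`-point of `Z|_k` lies in exactly one piece, namely that of `σ_P` (the pieces cover).
[folklore] -/
theorem iUnion_setOf_embOfPoint_eq :
    ⋃ σ : K →ₐ[k] L, {P : AlgPoints (Z.restrictScalars k) L | embOfPoint Z P = σ} = Set.univ :=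
  Set.eq_univ_of_forall fun P ↦ Set.mem_iUnion.mpr ⟨embOfPoint Z P, rfl⟩

/-- Distinct embeddings give disjoint pieces. [folklore] -/
theorem disjoint_setOf_embOfPoint_eq {σ τ : K →ₐ[k] L} (h : σ ≠ τ) :
    Disjoint {P : AlgPoints (Z.restrictScalars k) L | embOfPoint Z P = σ}
      {P | embOfPoint Z P = τ} :=
  Set.disjoint_left.mpr fun _ hσ hτ ↦ h (hσ.symm.trans hτ)

/-! #### The action of `Aut(L/k)` permutes the pieces -/

/-- **`Aut(L/k)` permutes the pieces**: `σ_{τ • P} = τ ∘ σ_P` (the action is `P ↦ Spec τ ≫ P`).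
For `k = ℚ`, `L = ℂ` and `τ` = complex conjugation: conjugation of complex points carries the
piece `W_σ(ℂ)` of `W|_ℚ(ℂ)` onto the piece `W_{σ̄}(ℂ)`. [folklore] -/
theorem embOfPoint_smul (τ : L ≃ₐ[k] L) (P : AlgPoints (Z.restrictScalars k) L) :
    embOfPoint Z (τ • P) = (τ : L →ₐ[k] L).comp (embOfPoint Z P) := by
  apply AlgHom.coe_ringHom_injective
  change (Spec.preimage ((τ • P).left ≫ Z.hom)).hom = (τ : L →+* L).comp (Spec.preimage (P.left ≫ Z.hom)).hom
  have h1 : (τ • P).left ≫ Z.hom =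
      Spec.map (CommRingCat.ofHom (τ : L →+* L)) ≫ (P.left ≫ Z.hom) :=
    Category.assoc _ _ _
  have h2 : Spec.preimage ((τ • P).left ≫ Z.hom) =
      Spec.preimage (P.left ≫ Z.hom) ≫ CommRingCat.ofHom (τ : L →+* L) := by
    apply Spec.map_injective
    rw [Spec.map_preimage, Spec.map_comp, Spec.map_preimage]
    exact h1
  rw [h2]
  rfl

/-- Hence `τ • P` lies in the piece of `τ ∘ σ` iff `P` lies in the piece of `σ`. [folklore] -/
theorem smul_mem_setOf_embOfPoint_eq_iff (τ : L ≃ₐ[k] L) (σ : K →ₐ[k] L)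
    (P : AlgPoints (Z.restrictScalars k) L) :
    τ • P ∈ {P : AlgPoints (Z.restrictScalars k) L | embOfPoint Z P = (τ : L →ₐ[k] L).comp σ} ↔
      P ∈ {P : AlgPoints (Z.restrictScalars k) L | embOfPoint Z P = σ} := by
  simp only [Set.mem_setOf_eq, embOfPoint_smul]
  constructor
  · intro h
    ext a
    have := AlgHom.congr_fun h a
    simpa using this
  · intro h
    rw [h]

end RestrictScalars

end AlgPoints

end Literature.AlgebraicGeometry.Motives

end
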